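import Literature.IUT.HodgeTheaters.PiAvatarOrbitCategoryProofs

/-!
# The Π-avatar orbit category: composition and equality of element-morphisms, commuting squares, and the
# lifting criterion for automorphisms along a morphism (proof-only; engine for law (β) at the instance)

S. Mochizuki, *Inter-universal Teichmüller theory I*, kurims manuscript (May 2020), §0 p. 33 (morphisms of
connected anabelioids = outer open homomorphisms), Def 4.1 (i) p. 95, Def 6.1 (v) p. 158, Example 6.3 (i)/(ii)
pp. 160–161 (`φ^{Θell}_{•,v}` "determined by the natural composite `X→_v → X_v → X_K`"; "one verifies immediately
that `φ^{Θell}_±` is equivariant") ([IUTchI] Ex 6.3 (ii) p.161) [claim: Mochizuki2012, status: disputed] (D-0012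
claim key, series status DISPUTED — GROUP-THEORETIC PLUMBING; nothing of the series is asserted, no side is taken
on [IUTchIII] Cor. 3.12).

Over abc-iut-L5-t4's orbit category `OrbitCat A` (p419432: objects `A/H`, morphisms `xH ↦ xaK` = `homOfElem`,
`Aut(A/H) = N_A(H)/H` = `autOfNormalizer`) this PROOF-ONLY file (abc-iut-L5-t13, the (β) discharge lineage)
records the calculus of commuting squares that the genuine-kit instance of the `[−1]`-compatibility law (β)
(`PMBaseKit.Ex63.NegCompatModel`, reduced to a label-free commutation condition by
`Ex63.negCompatModel_iff_commutes`, p420660) comes down to: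

* `homOfElem_eq_iff` — `(xH ↦ xaK) = (xH ↦ xa'K)` iff `a⁻¹a' ∈ K`;
* `homOfElem_comp_homOfElem` — `(xH ↦ xaK) ≫ (yK ↦ ybL) = (xH ↦ xabL)`;
* `autOfNormalizer_comp_homOfElem_eq_iff` — THE SQUARE CRITERION: for `m ∈ N_A(H)`, `n ∈ N_A(K)` and
  `c⁻¹Hc ≤ K`, `(xH ↦ xmH) ≫ (xH ↦ xcK) = (xH ↦ xcK) ≫ (yK ↦ ynK)` iff `(mc)⁻¹(cn) ∈ K`;
* `exists_aut_comp_eq_iff` — THE LIFTING CRITERION: the automorphism `yK ↦ ynK` of `A/K` lifts along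
  `xH ↦ xcK` to some automorphism of `A/H` iff some `m ∈ N_A(H)` has `(mc)⁻¹(cn) ∈ K`; along an INCLUSION
  `H ≤ K` (`c = 1`): iff the coset `nK` meets `N_A(H)` (`exists_aut_comp_incl_eq_iff`), in particular
  whenever `n` itself normalises `H` (`autOfNormalizer_comp_incl`).

Reading for [IUTchI] Ex 6.3 (ii) at the genuine data (abc-iut-L5-t4's design D1, one ambient `A = Π_{C_F}`; the local
model object `𝒟_v` = `ℬ(Π_v)⁰` for the subgroup `Π_v ≤ Π_{X̲_K}` of the local curve at `v`, the global `𝒟^{⊚±} = ℬ(X̲_K)⁰`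
= `ℬ(Π_{X̲_K})⁰`, `φ^{Θell}_{•,v}` = the inclusion): `[−1] = (yΠ_{X̲_K} ↦ ynΠ_{X̲_K})` with `n ∈ Π_{C̲_K} ∖ Π_{X̲_K}`
(abc-iut-L5-t4's `InitialThetaData.exists_globalInvolution`, p420587 → v2 p421129) lifts along `φ^{Θell}_{•,v}` iff SOME element
of the coset `nΠ_{X̲_K} = Π_{C̲_K} ∖ Π_{X̲_K}` normalises `Π_v`. Proof-only (no definitions, no `Prop` facts); typed ≠
proved elsewhere.
-/

namespace Literature.IUT.HodgeTheaters

open CategoryTheory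

universe u

namespace OrbitCat

variable {A : Type u} [Group A]

/-! ### Equality and composition of element-morphisms -/

/-- **`(xH ↦ xaK) = (xH ↦ xa'K)` iff `aK = a'K`**, i.e. `a⁻¹a' ∈ K` (evaluate at the coset of `1`): the element of a
morphism of embedded connected objects is determined up to RIGHT multiplication by the target subgroup
([IUTchI] §0 p. 33: homomorphisms up to inner automorphisms of the target).
([IUTchI] Def 4.1 (i) p.95) [claim: Mochizuki2012, status: disputed] -/
theorem homOfElem_eq_iff {H K : Subgroup A} {a a' : A} (h : ∀ x ∈ H, a⁻¹ * x * a ∈ K)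
    (h' : ∀ x ∈ H, a'⁻¹ * x * a' ∈ K) : homOfElem a h = homOfElem a' h' ↔ a⁻¹ * a' ∈ K := by
  constructor
  · intro e
    have h1 := congrArg (fun f => fn f (QuotientGroup.mk (1 : A))) e
    simp only [fn_homOfElem, one_mul] at h1
    exact QuotientGroup.eq.mp h1
  · intro hk
    apply hom_ext_fn
    funext q
    induction q using Quotient.inductionOn' with
    | h x =>
      change (QuotientGroup.mk (x * a) : A ⧸ K) = QuotientGroup.mk (x * a')
      rw [QuotientGroup.eq]
      simpa [mul_assoc, mul_inv_rev] using hk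

/-- If `a⁻¹Ha ≤ K` and `b⁻¹Kb ≤ L` then `(ab)⁻¹H(ab) ≤ L` (the element of a composite).
([IUTchI] Def 4.1 (i) p.95) [claim: Mochizuki2012, status: disputed] -/
theorem conj_mem_of_comp {H K L : Subgroup A} {a b : A} (ha : ∀ x ∈ H, a⁻¹ * x * a ∈ K)
    (hb : ∀ x ∈ K, b⁻¹ * x * b ∈ L) : ∀ x ∈ H, (a * b)⁻¹ * x * (a * b) ∈ L := fun x hx => by
  simpa [mul_assoc, mul_inv_rev] using hb _ (ha x hx)

/-- **Composition of element-morphisms**: `(xH ↦ xaK) ≫ (yK ↦ ybL) = (xH ↦ xabL)`.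
([IUTchI] Def 4.1 (i) p.95) [claim: Mochizuki2012, status: disputed] -/
theorem homOfElem_comp_homOfElem {H K L : Subgroup A} (a b : A) (ha : ∀ x ∈ H, a⁻¹ * x * a ∈ K)
    (hb : ∀ x ∈ K, b⁻¹ * x * b ∈ L) :
    homOfElem a ha ≫ homOfElem b hb = homOfElem (a * b) (conj_mem_of_comp ha hb) := by
  apply hom_ext_fn
  funext q
  induction q using Quotient.inductionOn' with
  | h x =>
    change fn (homOfElem b hb) (fn (homOfElem a ha) (QuotientGroup.mk x)) =
      (QuotientGroup.mk (x * (a * b)) : A ⧸ L)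
    rw [fn_homOfElem, fn_homOfElem, mul_assoc]
    exact rfl

/-- The automorphism `xH ↦ xnH` IS the element-morphism of `n` (definitional unfolding, recorded for rewriting).
([IUTchI] Def 6.1 (v) p.158) [claim: Mochizuki2012, status: disputed] -/
theorem autOfNormalizer_hom {H : Subgroup A} (n : A) (hn : n ∈ Subgroup.normalizer (H : Set A)) :
    (autOfNormalizer n hn).hom = homOfElem n (fun x hx => by
      have h := (Subgroup.mem_normalizer_iff.mp hn (n⁻¹ * x * n)).mpr
      apply h
      simpa [mul_assoc] using hx) :=
  rfl

/-! ### Commuting squares and the lifting criterion -/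

/-- **The square criterion.** For `m ∈ N_A(H)`, `n ∈ N_A(K)` and an element-morphism `xH ↦ xcK` (`c⁻¹Hc ≤ K`):
`(xH ↦ xmH) ≫ (xH ↦ xcK) = (xH ↦ xcK) ≫ (yK ↦ ynK)` iff `(mc)K = (cn)K`, i.e. `(mc)⁻¹(cn) ∈ K`. This is the shape of
"`a ≫ φ^{Θell}_{•,v} = φ^{Θell}_{•,v} ≫ b`" ([IUTchI] Ex 6.3 (ii) p. 161) in the Π-avatar.
([IUTchI] Ex 6.3 (ii) p.161) [claim: Mochizuki2012, status: disputed] -/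
theorem autOfNormalizer_comp_homOfElem_eq_iff {H K : Subgroup A} {m n c : A}
    (hm : m ∈ Subgroup.normalizer (H : Set A)) (hn : n ∈ Subgroup.normalizer (K : Set A))
    (hc : ∀ x ∈ H, c⁻¹ * x * c ∈ K) :
    (autOfNormalizer m hm).hom ≫ homOfElem c hc = homOfElem c hc ≫ (autOfNormalizer n hn).hom ↔
      (m * c)⁻¹ * (c * n) ∈ K := by
  constructor
  · intro e
    have h1 := congrArg (fun f => fn f (QuotientGroup.mk (1 : A))) e
    simp only [fn_comp, Function.comp_apply, fn_autOfNormalizer_hom, fn_homOfElem, one_mul] at h1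
    exact QuotientGroup.eq.mp h1
  · intro hk
    apply hom_ext_fn
    funext q
    induction q using Quotient.inductionOn' with
    | h x =>
      change (QuotientGroup.mk (x * m * c) : A ⧸ K) = QuotientGroup.mk (x * c * n)
      rw [QuotientGroup.eq]
      simpa [mul_assoc, mul_inv_rev] using hk

/-- **The lifting criterion.** The automorphism `yK ↦ ynK` of `A/K` (`n ∈ N_A(K)`) lifts along `xH ↦ xcK` to an
automorphism of `A/H` — i.e. some `a ∈ Aut(A/H)` makes the square commute — iff some `m ∈ N_A(H)` satisfies
`(mc)⁻¹(cn) ∈ K` (every automorphism of `A/H` is `xH ↦ xmH`, `exists_eq_autOfNormalizer`).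
([IUTchI] Ex 6.3 (ii) p.161) [claim: Mochizuki2012, status: disputed] -/
theorem exists_aut_comp_eq_iff {H K : Subgroup A} {n c : A}
    (hn : n ∈ Subgroup.normalizer (K : Set A)) (hc : ∀ x ∈ H, c⁻¹ * x * c ∈ K) :
    (∃ a : (of H : OrbitCat A) ≅ of H,
        a.hom ≫ homOfElem c hc = homOfElem c hc ≫ (autOfNormalizer n hn).hom) ↔
      ∃ m ∈ Subgroup.normalizer (H : Set A), (m * c)⁻¹ * (c * n) ∈ K := by
  constructor
  · rintro ⟨a, ha⟩
    obtain ⟨m, hm, rfl⟩ := exists_eq_autOfNormalizer a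
    exact ⟨m, hm, (autOfNormalizer_comp_homOfElem_eq_iff hm hn hc).1 ha⟩
  · rintro ⟨m, hm, hk⟩
    exact ⟨autOfNormalizer m hm, (autOfNormalizer_comp_homOfElem_eq_iff hm hn hc).2 hk⟩

/-- The element `1` carries `H` into any overgroup `K` (the inclusion `ℬ(H)⁰ → ℬ(K)⁰` as an element-morphism).
([IUTchI] Def 4.1 (i) p.95) [claim: Mochizuki2012, status: disputed] -/
theorem one_conj_mem_of_le {H K : Subgroup A} (hHK : H ≤ K) : ∀ x ∈ H, (1 : A)⁻¹ * x * 1 ∈ K :=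
  fun x hx => by simpa using hHK hx

/-- **Lifting along an inclusion.** For `H ≤ K` and `n ∈ N_A(K)`: the automorphism `yK ↦ ynK` of `A/K` lifts along
the inclusion `xH ↦ xK` iff the coset `nK` meets the normaliser `N_A(H)` (some `m ∈ N_A(H)` has `m⁻¹n ∈ K`). For
[IUTchI] Ex 6.3 (ii) p. 161: `[−1] ∈ Aut_±(𝒟^{⊚±})`, given by `n ∈ Π_{C̲_K} ∖ Π_{X̲_K}`, lifts along
`φ^{Θell}_{•,v} : ℬ(Π_v)⁰ → ℬ(Π_{X̲_K})⁰` iff some element of `Π_{C̲_K} ∖ Π_{X̲_K}` normalises `Π_v`.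
([IUTchI] Ex 6.3 (ii) p.161) [claim: Mochizuki2012, status: disputed] -/
theorem exists_aut_comp_incl_eq_iff {H K : Subgroup A} (hHK : H ≤ K) {n : A}
    (hn : n ∈ Subgroup.normalizer (K : Set A)) :
    (∃ a : (of H : OrbitCat A) ≅ of H,
        a.hom ≫ homOfElem 1 (one_conj_mem_of_le hHK) =
          homOfElem 1 (one_conj_mem_of_le hHK) ≫ (autOfNormalizer n hn).hom) ↔
      ∃ m ∈ Subgroup.normalizer (H : Set A), m⁻¹ * n ∈ K := by
  rw [exists_aut_comp_eq_iff hn (one_conj_mem_of_le hHK)]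
  simp only [mul_one, one_mul]

/-- **Lifting along an inclusion when `n` normalises both.** If `n ∈ N_A(H) ∩ N_A(K)` and `H ≤ K`, the square
`(xH ↦ xnH) ≫ incl = incl ≫ (yK ↦ ynK)` commutes on the nose — e.g. an element of `Π_{C̲_K} ∖ Π_{X̲_K}` lying in a
decomposition group at `v` and normalising the local subgroup `Π_v` realises `[−1]` compatibly at `v`
([IUTchI] Ex 6.3 (ii) p. 161). ([IUTchI] Ex 6.3 (ii) p.161) [claim: Mochizuki2012, status: disputed] -/
theorem autOfNormalizer_comp_incl {H K : Subgroup A} (hHK : H ≤ K) {n : A}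
    (hnH : n ∈ Subgroup.normalizer (H : Set A)) (hnK : n ∈ Subgroup.normalizer (K : Set A)) :
    (autOfNormalizer n hnH).hom ≫ homOfElem 1 (one_conj_mem_of_le hHK) =
      homOfElem 1 (one_conj_mem_of_le hHK) ≫ (autOfNormalizer n hnK).hom := by
  rw [autOfNormalizer_comp_homOfElem_eq_iff hnH hnK]
  simp

/-- **Uniqueness of the lift modulo `H`.** Two lifts `xH ↦ xmH`, `xH ↦ xm'H` of the same automorphism along the
same element-morphism `xH ↦ xcK` differ by an element of `c K c⁻¹ ∩ N_A(H)` — precisely: `(mc)⁻¹(m'c) ∈ K`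
([IUTchI] Ex 6.3 (i) p. 161: `φ^{Θell}_{v_0}` is a poly-morphism = an `Aut_+(𝒟_{v_0})`/`Aut_csp`-orbit, so lifts
are determined only up to such elements). ([IUTchI] Ex 6.3 (i) p.161) [claim: Mochizuki2012, status: disputed] -/
theorem lift_unique_mod {H K : Subgroup A} {m m' n c : A}
    (hm : m ∈ Subgroup.normalizer (H : Set A)) (hm' : m' ∈ Subgroup.normalizer (H : Set A))
    (hn : n ∈ Subgroup.normalizer (K : Set A)) (hc : ∀ x ∈ H, c⁻¹ * x * c ∈ K)
    (h : (autOfNormalizer m hm).hom ≫ homOfElem c hc = homOfElem c hc ≫ (autOfNormalizer n hn).hom)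
    (h' : (autOfNormalizer m' hm').hom ≫ homOfElem c hc = homOfElem c hc ≫ (autOfNormalizer n hn).hom) :
    (m * c)⁻¹ * (m' * c) ∈ K := by
  have h1 := (autOfNormalizer_comp_homOfElem_eq_iff hm hn hc).1 h
  have h2 := (autOfNormalizer_comp_homOfElem_eq_iff hm' hn hc).1 h'
  have e : (m * c)⁻¹ * (m' * c) = ((m * c)⁻¹ * (c * n)) * ((m' * c)⁻¹ * (c * n))⁻¹ := by group
  rw [e]
  exact K.mul_mem h1 (K.inv_mem h2)

end OrbitCat

end Literature.IUT.HodgeTheaters
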